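import Mathlib
import HarnessLib
import Summits.ValiantsHypothesis.ValiantsHypothesis.Theses.MonotoneRestoration
import Literature.Computability.AlgebraicComplexity.ArithCircuit
import Literature.Computability.AlgebraicComplexity.ArithCircuitProofs
import Literature.Computability.AlgebraicComplexity.MonotoneStructure
import Literature.Computability.AlgebraicComplexity.PermanentIrreducible
import Literature.ModelTheory.FiniteModelTheory.CkEquiv
import Summits.ValiantsHypothesis.ValiantsHypothesis.Theorems.MonotoneRestorationMonotoneRestorationQPCosetCount
import Summits.ValiantsHypothesis.ValiantsHypothesis.Theorems.MonotoneRestorationMonotoneRestorationQPSymmetricLB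
import Summits.ValiantsHypothesis.ValiantsHypothesis.Theorems.MonotoneRestorationMonotoneRestorationQPSupportSymmetrisation
import Summits.ValiantsHypothesis.ValiantsHypothesis.Theorems.MonotoneRestorationMonotoneRestorationQPSparseRegime
import Summits.ValiantsHypothesis.ValiantsHypothesis.Theorems.MonotoneRestorationMonotoneRestorationQPBeta
import Literature.Computability.AlgebraicComplexity.SymmetricArithCircuit
import Literature.Computability.AlgebraicComplexity.DawarWilsenach2025Proofs
import Literature.GroupTheory.PermutationGroups.SmallIndexSubgroups
import Summits.ValiantsHypothesis.ValiantsHypothesis.Theorems.MonotoneRestorationQP.Negative.LoadBearing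
import Summits.ValiantsHypothesis.ValiantsHypothesis.Theorems.MonotoneRestorationMonotoneRestorationQPPermSupportCount

/-! TTRL-lite variant V20125 of stmt-ValiantsHypothesis-15886 -/

set_option linter.dupNamespace false

namespace Summit.ValiantsHypothesis.ValiantsHypothesis.Theorems

open Summit.ValiantsHypothesis.ValiantsHypothesis.Theses.MonotoneRestoration
open Literature.Computability.AlgebraicComplexity

/-- TTRL-lite variant V20125 (`lemma_proposal`) of `stmt-ValiantsHypothesis-15886`: the bridge
between the `match`-form heredity clause on an operand `u` of a supported straight-line program
(both indices of a variable `x_{pq}` lie in `K i`; nothing for a constant; `K j ⊆ K i` for a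
reference to gate `j`) and the Literature form `SupportSymm.osupp K u ⊆ K i`
(`osupp K (var pq) = {pq.1, pq.2}`, `osupp K (const c) = ∅`, `osupp K (gate j) = K j`).
By cases on `u`. [folklore] -/
theorem stub_monotoneSupportReduction_var20125 :
    ∀ (n : ℕ) (K : ℕ → Finset (Fin n)) (i : ℕ) (u : ArithCircuit.Operand ℂ (Fin n × Fin n)),
      (match u with
        | .var pq => pq.1 ∈ K i ∧ pq.2 ∈ K i
        | .const _ => True
        | .gate j => K j ⊆ K i) ↔ SupportSymm.osupp K u ⊆ K i := by
  intro n K i u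
  cases u with
  | var pq => simp only [SupportSymm.osupp, Finset.insert_subset_iff, Finset.singleton_subset_iff]
  | const c => simp only [SupportSymm.osupp, Finset.empty_subset]
  | gate j => simp only [SupportSymm.osupp]

end Summit.ValiantsHypothesis.ValiantsHypothesis.Theorems
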